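import Summits.PneNP.PneNP.Theorems.ConvexRankGatesLinAlgGateBlindTermCollapse
import Summits.PneNP.PneNP.Theorems.ConvexRankGatesLinAlgGateBlindPluckingBound
import Summits.PneNP.PneNP.Theorems.ConvexRankGatesLinAlgGateBlindWideApproxHost
import Summits.PneNP.PneNP.Theorems.ConvexRankGatesLinAlgGateBlindDenseRegime
import Summits.PneNP.PneNP.Theorems.ConvexRankGatesLinAlgGateBlindReduction

/-!
# Route ConvexRankGates, crux `LinAlgGateBlind` (stmt-PneNP-10681): the door theorem at an arbitrary atom width `l`

Support theorems for the crux (vocabulary of `Theorems/ConvexRankGatesLinAlgGateBlindDefs.lean`). The tree's door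
theorem `not_computes_clique_of_collapse` (`…Theorems.ConvexRankGatesLinAlgGateBlindDoorHost`) runs the Alon–Boppana
host `stub_wideApproxHost` in the lattice `K(m, rOf c m, lOf m)` at the FIXED atom width `l = lOf m ≈ m^{1/16}`; but
the host is a theorem about arbitrary `(k, r, l, q, ε)` and every budget of the dense regime only improves when `l`
decreases (as long as `l ≥ 2c + 8`, which keeps the trimming count `((r-1)^l)² C(m-l-1, k-l-1)` below
`ε C(m,k)`), while the single-gate statement `SGAt m P l k q ε` for the wide gates becomes EASIER to supply at a
smaller width (the union-bound covers of the planting theorem are indexed by `≤ l`-sets). This file makes the width a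
parameter:

* `denseRegime_level` — for every `c`, eventually in `m`, for EVERY `l` with `2c + 8 ≤ l ≤ lOf m`, all ten conjuncts of
  `stub_denseRegime` hold at `(kOf m, r, l, qOf m, epsOf c m)` with the sunflower parameter
  `r = (l + c + 2)(⌊log₂ m⌋ + 1) + 2`;
* `not_computes_clique_of_collapse_level` — **the door theorem at level `l`**: for every `c`, eventually in `m`, for
  every `l ∈ [2c + 8, lOf m]`, every set `W` of monotone gates collapsing into a term-gate class `P` at width `l` with
  `SGAt m P l (kOf m) (qOf m) (epsOf c m)` is blind to `CLIQUE(m, ⌈m^{1/8}⌉)` at size `m^c`.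

The case `l = lOf m` is the tree's door theorem; the log-width case `l = Θ((c+1) log m)` is what pushes the PERM door to
`d ≤ m^{7/8-o(1)}` (`…Theorems.ConvexRankGatesLinAlgGateBlindLogWidthPerm`). Sources: Razborov 1985, Alon–Boppana 1987 §3
(parameter calculus); the host, plucking bound and trimming count are the tree's. No new definitions. [folklore]
-/

-- `Summit.PneNP.PneNP.…` duplicates `PneNP` BY DESIGN (single-problem summit).
set_option linter.dupNamespace false

noncomputable section

namespace Summit.PneNP.PneNP.Theorems

open Finset Filter Literature.Computability.Complexity Razborov
open Summit.PneNP.PneNP.Cruxes.LinAlgGateBlind.DnfInvariantWideGatesSeeSmallCliques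
open Summit.PneNP.PneNP.Cruxes.LinAlgGateBlind.DnfInvariantWideGatesSeeSmallCliques.DenseRegime

/-! ### Pointwise budgets at level `l` -/

/-- The plucking budget in `ℕ` at level `l`: `4 (m+1)^l m^{c+1} ≤ 2^r` for `r = (l + c + 2)(⌊log₂ m⌋ + 1) + 2`
(`m + 1 ≤ 2^{⌊log₂ m⌋ + 1}`). [folklore] -/
theorem four_mul_pow_le_two_pow_level (c m l : ℕ) :
    4 * (m + 1) ^ l * m ^ (c + 1) ≤ 2 ^ ((l + c + 2) * (Nat.log 2 m + 1) + 2) := by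
  have h : m + 1 ≤ 2 ^ (Nat.log 2 m + 1) := Nat.lt_pow_succ_log_self one_lt_two m
  have h1 : m ^ (c + 1) ≤ (m + 1) ^ (c + 2) :=
    (Nat.pow_le_pow_left (Nat.le_succ m) _).trans (Nat.pow_le_pow_right (Nat.succ_pos m) (Nat.le_succ _))
  calc 4 * (m + 1) ^ l * m ^ (c + 1)
      ≤ 4 * (m + 1) ^ l * (m + 1) ^ (c + 2) := Nat.mul_le_mul_left _ h1
    _ = 4 * (m + 1) ^ (l + c + 2) := by rw [mul_assoc, ← pow_add, add_assoc]
    _ ≤ 4 * (2 ^ (Nat.log 2 m + 1)) ^ (l + c + 2) :=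
        Nat.mul_le_mul_left _ (Nat.pow_le_pow_left h _)
    _ = 2 ^ ((l + c + 2) * (Nat.log 2 m + 1) + 2) := by
        rw [← pow_mul, pow_add, mul_comm (4 : ℕ), mul_comm (Nat.log 2 m + 1)]
        norm_num

/-- `q^{C(l,2)} ≥ 1/2` for every `l ≤ lOf m` (Bernoulli at `lOf m`, antitonicity of `n ↦ q^n`). [folklore] -/
theorem half_le_qOf_pow_level {m l : ℕ} (hm : 1 ≤ m) (hLk : 4 * Real.log m ≤ (kOf m : ℝ)) (hl : l ≤ lOf m) :
    (1 / 2 : ℝ) ≤ qOf m ^ (l.choose 2) :=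
  (half_le_qOf_pow hm hLk).trans
    (pow_le_pow_of_le_one (qOf_nonneg hm hLk) (qOf_le_one m) (Nat.choose_le_choose 2 hl))

/-- **Plucking budget at level `l`.** `|𝒱(l)|·(1 - q^{C(l,2)})^r ≤ (m+1)^l 2^{-r} ≤ ε` for `l ≤ lOf m` and
`r = (l + c + 2)(⌊log₂ m⌋ + 1) + 2`. [folklore] -/
theorem plucking_le_level {c m l : ℕ} (hm : 1 ≤ m) (hLk : 4 * Real.log m ≤ (kOf m : ℝ)) (hl : l ≤ lOf m) :
    (#(smallSets (Fin m) l) : ℝ) * (1 - qOf m ^ (l.choose 2)) ^ ((l + c + 2) * (Nat.log 2 m + 1) + 2) ≤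
      epsOf c m := by
  set r := (l + c + 2) * (Nat.log 2 m + 1) + 2 with hrdef
  have hhalf := half_le_qOf_pow_level hm hLk hl
  have hq0 := qOf_nonneg hm hLk
  have hq1 := qOf_le_one m
  have hqN1 : qOf m ^ (l.choose 2) ≤ 1 := pow_le_one₀ hq0 hq1
  have hb0 : 0 ≤ 1 - qOf m ^ (l.choose 2) := by linarith
  have hb1 : 1 - qOf m ^ (l.choose 2) ≤ 1 / 2 := by linarith
  have hcard : (#(smallSets (Fin m) l) : ℝ) ≤ ((m + 1 : ℕ) : ℝ) ^ l := by
    have := card_smallSets_le (α := Fin m) l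
    rw [Fintype.card_fin] at this
    exact_mod_cast this
  have hnat := four_mul_pow_le_two_pow_level c m l
  have hnat' : (4 : ℝ) * ((m + 1 : ℕ) : ℝ) ^ l * (m : ℝ) ^ (c + 1) ≤ (2 : ℝ) ^ r := by
    exact_mod_cast hnat
  have hmpos : (0 : ℝ) < m := by exact_mod_cast hm
  calc (#(smallSets (Fin m) l) : ℝ) * (1 - qOf m ^ (l.choose 2)) ^ r
      ≤ ((m + 1 : ℕ) : ℝ) ^ l * (1 / 2) ^ r :=
        mul_le_mul hcard (pow_le_pow_left₀ hb0 hb1 _) (pow_nonneg hb0 _) (by positivity)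
    _ = ((m + 1 : ℕ) : ℝ) ^ l / 2 ^ r := by rw [one_div, inv_pow, div_eq_mul_inv]
    _ ≤ epsOf c m := by
        rw [epsOf_eq, div_le_div_iff₀ (by positivity) (by positivity), one_mul]
        linarith

/-- **Trimming budget at level `l`.** `((r-1)^l)² C(m-l-1, k-l-1) ≤ ε C(m,k)` whenever `x = m^{1/16} ≥ 2`, `r ≤ x²`,
`2c + 1 ≤ l` and `l + 1 ≤ k` (the computation of `DenseRegime.trimming_le`, verbatim at level `l`). [folklore] -/
theorem trimming_le_level {c m l r : ℕ} (hm : 1 ≤ m) (hx2 : (2 : ℝ) ≤ (m : ℝ) ^ (1 / 16 : ℝ))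
    (hr : (r : ℝ) ≤ ((m : ℝ) ^ (1 / 16 : ℝ)) ^ 2) (hl : 2 * c + 1 ≤ l) (hlk : l + 1 ≤ kOf m) :
    ((((r - 1) ^ l) ^ 2 * (m - (l + 1)).choose (kOf m - (l + 1)) : ℕ) : ℝ) ≤
      epsOf c m * (m.choose (kOf m) : ℝ) := by
  set x := (m : ℝ) ^ (1 / 16 : ℝ) with hxdef
  set k := kOf m
  have hkm : k ≤ m := kOf_le_self m
  have hnat := choose_sub_mul_pow_le_pow_mul_choose (l + 1) m k hlk hkm
  have hmx : (m : ℝ) = x ^ 16 := (rpow_sixteenth_pow m).symm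
  have hmpos : (0 : ℝ) < m := by exact_mod_cast hm
  have hx0 : (0 : ℝ) ≤ x := Real.rpow_nonneg (Nat.cast_nonneg m) _
  have hx1 : (1 : ℝ) ≤ x := by linarith
  have hk2 : (k : ℝ) ≤ 2 * x ^ 2 := kOf_le_two_mul_sq hm
  have hr1 : ((r - 1 : ℕ) : ℝ) ≤ x ^ 2 := le_trans (by exact_mod_cast Nat.sub_le r 1) hr
  have hreal : (((m - (l + 1)).choose (k - (l + 1)) : ℕ) : ℝ) * (m : ℝ) ^ (l + 1) ≤
      (k : ℝ) ^ (l + 1) * (m.choose k : ℝ) := by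
    exact_mod_cast hnat
  have hC : (0 : ℝ) ≤ (m.choose k : ℝ) := Nat.cast_nonneg _
  have key : 2 ^ (l + 1) * x ^ (6 * l + 2) * (4 * (x ^ 16) ^ (c + 1)) ≤ (x ^ 16) ^ (l + 1) := by
    have h2x : (2 : ℝ) ^ (l + 3) ≤ x ^ (l + 3) := pow_le_pow_left₀ (by norm_num) hx2 _
    calc 2 ^ (l + 1) * x ^ (6 * l + 2) * (4 * (x ^ 16) ^ (c + 1))
        = 2 ^ (l + 3) * x ^ (6 * l + 16 * c + 18) := by ring
      _ ≤ x ^ (l + 3) * x ^ (6 * l + 16 * c + 18) := mul_le_mul_of_nonneg_right h2x (by positivity)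
      _ = x ^ (7 * l + 16 * c + 21) := by rw [← pow_add]; ring_nf
      _ ≤ x ^ (16 * (l + 1)) := pow_le_pow_right₀ hx1 (by omega)
      _ = (x ^ 16) ^ (l + 1) := pow_mul x 16 (l + 1)
  rw [← mul_le_mul_iff_left₀ (pow_pos hmpos (l + 1))]
  calc ((((r - 1) ^ l) ^ 2 * (m - (l + 1)).choose (k - (l + 1)) : ℕ) : ℝ) * (m : ℝ) ^ (l + 1)
      = (((r - 1 : ℕ) : ℝ) ^ l) ^ 2 *
          ((((m - (l + 1)).choose (k - (l + 1)) : ℕ) : ℝ) * (m : ℝ) ^ (l + 1)) := by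
        simp only [Nat.cast_mul, Nat.cast_pow]; ring
    _ ≤ (((r - 1 : ℕ) : ℝ) ^ l) ^ 2 * ((k : ℝ) ^ (l + 1) * (m.choose k : ℝ)) :=
        mul_le_mul_of_nonneg_left hreal (by positivity)
    _ ≤ ((x ^ 2) ^ l) ^ 2 * ((2 * x ^ 2) ^ (l + 1) * (m.choose k : ℝ)) := by gcongr
    _ = (2 ^ (l + 1) * x ^ (6 * l + 2)) * (m.choose k : ℝ) := by ring
    _ ≤ epsOf c m * (m.choose k : ℝ) * (m : ℝ) ^ (l + 1) := by
        rw [epsOf_eq, hmx]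
        rw [show 1 / (4 * (x ^ 16) ^ (c + 1)) * (m.choose k : ℝ) * (x ^ 16) ^ (l + 1) =
            (m.choose k : ℝ) * (x ^ 16) ^ (l + 1) / (4 * (x ^ 16) ^ (c + 1)) by ring]
        rw [le_div_iff₀ (by positivity)]
        calc 2 ^ (l + 1) * x ^ (6 * l + 2) * (m.choose k : ℝ) * (4 * (x ^ 16) ^ (c + 1))
            = (2 ^ (l + 1) * x ^ (6 * l + 2) * (4 * (x ^ 16) ^ (c + 1))) * (m.choose k : ℝ) := by ring
          _ ≤ (x ^ 16) ^ (l + 1) * (m.choose k : ℝ) := mul_le_mul_of_nonneg_right key hC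
          _ = (m.choose k : ℝ) * (x ^ 16) ^ (l + 1) := mul_comm _ _

/-- The level-`l` sunflower parameter is monotone in `l`: `r(l) ≤ rOf c m` for `l ≤ lOf m`. [folklore] -/
theorem level_r_le_rOf {c m l : ℕ} (hl : l ≤ lOf m) : (l + c + 2) * (Nat.log 2 m + 1) + 2 ≤ rOf c m := by
  unfold rOf
  exact Nat.add_le_add_right (Nat.mul_le_mul_right _ (by omega)) 2

/-! ### The dense regime at level `l` -/

/-- **The dense regime at every level `l ∈ [2c + 8, lOf m]`.** For every `c`, eventually in `m`, for every such `l`,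
with `k = kOf m`, `r = (l + c + 2)(⌊log₂ m⌋ + 1) + 2`, `q = qOf m`, `ε = epsOf c m`: `l ≥ 2`, `r ≥ 2`, `k ≤ m`,
`0 ≤ q ≤ 1`, the plucking budget `|𝒱(l)| (1 - q^{C(l,2)})^r ≤ ε`, the trimming budget
`((r-1)^l)² C(m-l-1, k-l-1) ≤ ε C(m,k)`, `m^c ε ≤ 1/16`, `Pr_{G(m,q)}[ω ≥ k] ≤ 1/4` and `q^{C(l,2)} ≥ 1/2`
(the ten conjuncts of `stub_denseRegime`, which is the case `l = lOf m`). [folklore] -/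
theorem denseRegime_level : ∀ c : ℕ, ∀ᶠ m : ℕ in atTop, ∀ l : ℕ, 2 * c + 8 ≤ l → l ≤ lOf m →
    2 ≤ l ∧ 2 ≤ (l + c + 2) * (Nat.log 2 m + 1) + 2 ∧ kOf m ≤ m ∧ 0 ≤ qOf m ∧ qOf m ≤ 1 ∧
    (#(smallSets (Fin m) l) : ℝ) * (1 - qOf m ^ (l.choose 2)) ^ ((l + c + 2) * (Nat.log 2 m + 1) + 2) ≤
      epsOf c m ∧
    (((((l + c + 2) * (Nat.log 2 m + 1) + 2 - 1) ^ l) ^ 2 * (m - (l + 1)).choose (kOf m - (l + 1)) : ℕ) : ℝ) ≤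
      epsOf c m * (m.choose (kOf m) : ℝ) ∧
    ((m ^ c : ℕ) : ℝ) * epsOf c m ≤ 1 / 16 ∧
    prob (qOf m) (fun x : KEdge m → Bool => cliqueFn m (kOf m) x = true) ≤ 1 / 4 ∧
    (1 / 2 : ℝ) ≤ qOf m ^ (l.choose 2) := by
  intro c
  filter_upwards [denseRegime_params c, stub_denseRegime c] with m ⟨hm4, hL, hc, _⟩ hR l hcl hl
  obtain ⟨-, -, hkm, hq0, hq1, -, -, heps, hclq, -⟩ := hR
  have hm1 : 1 ≤ m := by omega
  have hm3 : 3 ≤ m := by omega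
  have hx2 : (2 : ℝ) ≤ (m : ℝ) ^ (1 / 16 : ℝ) := by
    have : (0 : ℝ) ≤ c := Nat.cast_nonneg c
    linarith
  have hLk := four_mul_log_le_kOf hm1 hL
  have hlk : l + 1 ≤ kOf m := le_trans (by omega) (lOf_add_one_le_kOf hx2)
  have hr : ((((l + c + 2) * (Nat.log 2 m + 1) + 2 : ℕ) : ℝ)) ≤ ((m : ℝ) ^ (1 / 16 : ℝ)) ^ 2 :=
    le_trans (by exact_mod_cast level_r_le_rOf (c := c) hl) (rOf_le_sq hm3 hL hc)
  exact ⟨by omega, Nat.le_add_left 2 _, hkm, hq0, hq1, plucking_le_level hm1 hLk hl,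
    trimming_le_level hm1 hx2 hr (by omega) hlk, heps, hclq, half_le_qOf_pow_level hm1 hLk hl⟩

/-! ### The door theorem at level `l` -/

/-- **The door theorem at level `l`.** For every `c`, eventually in `m`, for EVERY atom width `l` with
`2c + 8 ≤ l ≤ lOf m`: let `W` be any set of MONOTONE gates and `P` any class of term gates such that (a) every
`g ∈ W` fed with small-clique DNFs `⌈A_i⌉`, `A_i ⊆ 𝒱(l)`, is a term gate of class `P` over `≤ l`-atoms, and (b)
`SGAt m P l (kOf m) (qOf m) (epsOf c m)`. Then no circuit over `{∧₂, ∨₂} ∪ W` with `≤ m^c` gates computes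
`CLIQUE(m, ⌈m^{1/8}⌉)`. Proof: the host `stub_wideApproxHost` in `K(m, r, l)`, `r = (l + c + 2)(⌊log₂ m⌋ + 1) + 2`, with
`t = m^c`, `εP = ε`, `εN = 2ε`, fed by `denseRegime_level`, the plucking bound, the wide trimming count, (a), (b) and
re-closure of the supplied approximator at plucking cost `≤ ε` — the proof of `not_computes_clique_of_collapse`
verbatim at level `l` (which is its case `l = lOf m`). [folklore] -/
theorem not_computes_clique_of_collapse_level : ∀ c : ℕ, ∀ᶠ m : ℕ in atTop, ∀ l : ℕ, 2 * c + 8 ≤ l → l ≤ lOf m →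
    ∀ (W : Set GateFn) (P : GateFn → Prop), (∀ g ∈ W, Monotone g.2) →
    (∀ g ∈ W, ∀ A : Fin g.1 → Finset (Finset (Fin m)), (∀ i, A i ⊆ smallSets (Fin m) l) →
        IsTermGate m P l (fun x => g.2 fun i => acceptsB (A i) x)) →
    SGAt m P l (kOf m) (qOf m) (epsOf c m) →
    ∀ C : Circuit (KEdge m), C.IsOver ({GateFn.and 2, GateFn.or 2} ∪ W) →
      C.size ≤ m ^ c → ¬ C.Computes (cliqueFn m ⌈(m : ℝ) ^ (1 / 8 : ℝ)⌉₊) := by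
  intro c
  filter_upwards [denseRegime_level c] with m hm l hcl hl W P hmono hcollapse hSG C hC hsize
  obtain ⟨hl2, hr2, hkm, hq0, hq1, hpl, hand, heps, hclq, hhalf⟩ := hm l hcl hl
  set r := (l + c + 2) * (Nat.log 2 m + 1) + 2 with hrdef
  have hε : 0 ≤ epsOf c m := epsOf_nonneg c m
  refine stub_wideApproxHost m (kOf m) r l (m ^ c) (qOf m) (epsOf c m) (2 * epsOf c m)
    W hr2 hl2 hkm hq0 hq1 hε (mul_nonneg (by norm_num) hε) hmono ?_ ?_ ?_ ?_ ?_ C hC hsize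
  · -- (∨): plucking within budget
    intro A B hA hB
    calc prob (qOf m) (fun x : KEdge m → Bool => Accepts (closure r l (A ∪ B)) x ∧ ¬ Accepts (A ∪ B) x)
        ≤ (#(smallSets (Fin m) l) : ℝ) * (1 - qOf m ^ (l.choose 2)) ^ r :=
          stub_pluckingBound m r l (qOf m) hq0 hq1 (A ∪ B) (union_subset hA.subset hB.subset)
      _ ≤ epsOf c m := hpl
      _ ≤ 2 * epsOf c m := by linarith
  · -- (∧): trimming count within budget
    intro A B hA hB
    calc (#(errPos (kOf m) A B) : ℝ)
        ≤ ((((r - 1) ^ l) ^ 2 * (m - (l + 1)).choose (kOf m - (l + 1)) : ℕ) : ℝ) := by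
          exact_mod_cast card_errPos_le_wide hr2 hA hB
      _ ≤ epsOf c m * (m.choose (kOf m) : ℝ) := hand
  · -- gates of `W`: collapse (a), approximate (b), re-close
    intro g hg A hA
    have hsub : ∀ i, A i ⊆ smallSets (Fin m) l := fun i => (hA i).subset
    obtain ⟨𝒜, h𝒜, hlost, hgain⟩ := hSG _ (hcollapse g hg A hsub)
    refine ⟨closure r l 𝒜, isClosedFamily_closure _ _ _, ?_, ?_⟩
    · calc (#(lostPos m (kOf m) (fun x => g.2 fun i => acceptsB (A i) x) (closure r l 𝒜)) : ℝ)
          ≤ (#(lostPos m (kOf m) (fun x => g.2 fun i => acceptsB (A i) x) 𝒜) : ℝ) := by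
            exact_mod_cast card_le_card (lostPos_anti' _ (subset_closure h𝒜))
        _ ≤ epsOf c m * (m.choose (kOf m) : ℝ) := hlost
    · calc gainedNeg m (qOf m) (fun x => g.2 fun i => acceptsB (A i) x) (closure r l 𝒜)
          ≤ gainedNeg m (qOf m) (fun x => g.2 fun i => acceptsB (A i) x) 𝒜 +
              prob (qOf m) (fun x : KEdge m → Bool => Accepts (closure r l 𝒜) x ∧ ¬ Accepts 𝒜 x) :=
            gainedNeg_le_add' hq0 hq1 _ _ _
        _ ≤ epsOf c m + (#(smallSets (Fin m) l) : ℝ) * (1 - qOf m ^ (l.choose 2)) ^ r :=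
            add_le_add hgain (stub_pluckingBound m r l (qOf m) hq0 hq1 𝒜 h𝒜)
        _ ≤ 2 * epsOf c m := by linarith
  · -- positive-side endgame budget
    exact lt_of_le_of_lt heps (by norm_num)
  · -- negative-side endgame budget
    have h2 : ((m ^ c : ℕ) : ℝ) * (2 * epsOf c m) = 2 * (((m ^ c : ℕ) : ℝ) * epsOf c m) := by ring
    rw [h2]
    linarith

/-- **The door theorem at level `l`, single-gate-statement form with a level function.** If `W m` collapses into
`P m` at every width and, for some width function `lv` with `2c + 8 ≤ lv c m ≤ lOf m` eventually, `P m` satisfies the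
single-gate statement at width `lv c m` and every level `c`, then `W`-circuits of polynomial size are blind to
`CLIQUE(m, ⌈m^{1/8}⌉)`. [folklore] -/
theorem not_computes_clique_of_sgAt_level : ∀ (W : ℕ → Set GateFn) (P : ℕ → GateFn → Prop) (lv : ℕ → ℕ → ℕ),
    (∀ m, ∀ g ∈ W m, Monotone g.2) →
    (∀ m l, ∀ g ∈ W m, ∀ A : Fin g.1 → Finset (Finset (Fin m)),
      (∀ i, A i ⊆ smallSets (Fin m) l) → IsTermGate m (P m) l (fun x => g.2 fun i => acceptsB (A i) x)) →
    (∀ c : ℕ, ∀ᶠ m : ℕ in atTop, 2 * c + 8 ≤ lv c m ∧ lv c m ≤ lOf m ∧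
      SGAt m (P m) (lv c m) (kOf m) (qOf m) (epsOf c m)) → ∀ c : ℕ,
    ∀ᶠ m : ℕ in atTop, ∀ C : Circuit (KEdge m), C.IsOver ({GateFn.and 2, GateFn.or 2} ∪ W m) →
      C.size ≤ m ^ c → ¬ C.Computes (cliqueFn m ⌈(m : ℝ) ^ (1 / 8 : ℝ)⌉₊) := by
  intro W P lv hmono hcollapse hSG c
  filter_upwards [not_computes_clique_of_collapse_level c, hSG c] with m hm ⟨h1, h2, hP⟩
  exact hm (lv c m) h1 h2 (W m) (P m) (hmono m) (fun g hg A hA => hcollapse m (lv c m) g hg A hA) hP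

end Summit.PneNP.PneNP.Theorems

end
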